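import Summits.Ventures.QEC.CircuitDistance.ETowerZeroMemZ
import Summits.Ventures.QEC.CircuitDistance.ETowerSoundX
import HarnessLib

/-!
# P3-PORT STEP 2 (E-fold tower), sector X: the step-A zero fibre with CONDITIONAL D-list node facts (§B10, crit-1 g3
# data-interface note 04:22Z; cell `qec`, experiment CDX, seat qec-cdx-type-1)

Twin of `ETowerSoundX.zeroA_of_certsX` / `k2_bb144_X_of_certs` whose D-list node facts carry the KERNEL-MEMBERSHIP guard the
emitter writes (`zmem𝑃 : (D𝑃.all fun c => !(lin (tab TF w) ns 0 c == 0) || node …) = true`, membership form here):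
only D-list entries whose fibre-table syndrome vanishes need to pass the next node — exactly what `goodFibK_zero` asks
(`kerK col (nK G 5) (doubleK G 5 c) →`, converted by `kerK_doubleK_iff`).  (Generic glue `goodQ_of_bits_doubleK_mem` from the Z file.)
No `native_decide`; nothing here asserts a value of `d_circ`.
-/

set_option maxRecDepth 100000
set_option exponentiation.threshold 1024

namespace Summit.Ventures.QEC.CircuitDistance.ETower.SecX

open Summit.Ventures.QEC.Census Summit.Ventures.QEC.Census.Fold Summit.Ventures.QEC.CircuitDistance.ETower K2

/-- ★ **THE STEP-A ZERO FIBRE of sector X from the certificates, guarded D-list facts.** -/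
theorem zeroA_of_zmemX (hW3 : ∀ r ∈ W3C, NC r) {DA DB DC : List ℕ}
    (hmC : ∀ c ∈ DC, lin (tab TFC 72) 180 0 c = 0 → ktop (bitsOf 360 0 (doubleK GC 5 c)) = true)
    (hmB : ∀ c ∈ DB, lin (tab TFB 42) 90 0 c = 0 → nodeC (bitsOf 180 0 (doubleK GB 5 c)) = true)
    (hmA : ∀ c ∈ DA, lin (tab TFA 24) 45 0 c = 0 → nodeB (bitsOf 90 0 (doubleK GA 5 c)) = true)
    (hzC : ∀ b, b < 5 → ∀ k, k < 4 →
      zl k (tab TFC 72) (matchedB 6 6 5 DC) (tab TFC 72 (b * 36)) (2 ^ (b * 36)) (b * 36 + 1) 180 = true)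
    (hzB : ∀ b, b < 5 → ∀ k, k < 4 →
      zl k (tab TFB 42) (matchedB 6 3 5 DB) (tab TFB 42 (b * 18)) (2 ^ (b * 18)) (b * 18 + 1) 90 = true)
    (hzA : ∀ b, b < 5 → ∀ k, k < 4 →
      zl k (tab TFA 24) (matchedB 3 3 5 DA) (tab TFA 24 (b * 9)) (2 ^ (b * 9)) (b * 9 + 1) 45 = true) :
    GoodFibK GA 5 col2 9 NB 0 := by
  -- level C
  have hC0 : NC 0 := by
    refine goodFibK_zero (G := GC) SecZ.shapeC SecZ.okC hK0 (Q := QT) hQTX qTop_zero DC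
      (zeroD_of_zcert (G := GC) (M := tab TFC 72) SecZ.shapeC SecZ.okC hMC hK0 (W := 9) (h := 4) (by norm_num) ?_) ?_
    · intro b hb k hk
      have e1 : GC.ls = 6 := by decide
      have e2 : GC.ms = 6 := by decide
      have e3 : nsK GC 5 = 180 := by decide
      rw [e1, e2, e3]; simp only [Nat.reduceMul]; exact hzC b hb k hk
    · intro c hc hk
      exact goodQ_of_bits_doubleK_mem (G := GC) (M := tab TFC 72) SecZ.okC (by decide) hMC (node := ktop)
        (fun S hS hl h => hktopX S hS hl h) (hmC c hc) hk
  -- level B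
  have hB0 : NB 0 := by
    refine goodFibK_zero (G := GB) SecZ.shapeB SecZ.okB hK1 (Q := NC) hNCX hC0 DB
      (zeroD_of_zcert (G := GB) (M := tab TFB 42) SecZ.shapeB SecZ.okB hMB hK1 (W := 9) (h := 4) (by norm_num) ?_) ?_
    · intro b hb k hk
      have e1 : GB.ls = 6 := by decide
      have e2 : GB.ms = 3 := by decide
      have e3 : nsK GB 5 = 90 := by decide
      rw [e1, e2, e3]; simp only [Nat.reduceMul]; exact hzB b hb k hk
    · intro c hc hk
      exact goodQ_of_bits_doubleK_mem (G := GB) (M := tab TFB 42) SecZ.okB (by decide) hMB (node := nodeC)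
        (fun S hS _ h => hkCX hW3 S hS h) (hmB c hc) hk
  -- level A
  refine goodFibK_zero (G := GA) SecZ.shapeA SecZ.okA hK2 (Q := NB) hNBX hB0 DA
    (zeroD_of_zcert (G := GA) (M := tab TFA 24) SecZ.shapeA SecZ.okA hMA hK2 (W := 9) (h := 4) (by norm_num) ?_) ?_
  · intro b hb k hk
    have e1 : GA.ls = 3 := by decide
    have e2 : GA.ms = 3 := by decide
    have e3 : nsK GA 5 = 45 := by decide
    rw [e1, e2, e3]; simp only [Nat.reduceMul]; exact hzA b hb k hk
  · intro c hc hk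
    exact goodQ_of_bits_doubleK_mem (G := GA) (M := tab TFA 24) SecZ.okA (by decide) hMA (node := nodeB)
      (fun S hS _ h => hkBX hW3 S hS h) (hmA c hc) hk

/-- ★★ **`K2_BB144_X` from data only, guarded D-list facts**: units, windows, base slices, three brute-anchored zero
certificates, three guarded D-list node facts. -/
theorem k2_bb144_X_of_zmem {T3 DA DB DC : List ℕ}
    (hU : ∀ t ∈ T3, nodeA (bitsOf 45 0 t) = true)
    (hW : ∀ L ∈ W3L, ∀ w ∈ W3WIN3, nodeCW L w = true)
    (hBcheck : sliceCheck col3 3 3 5 9 T3 = true) (hBincr : Fibre.incr T3 = true)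
    (hBsum : ∀ w, 1 ≤ w → w ≤ 9 → osum 3 3 5 w T3 = NW.getD w 0)
    (hmC : ∀ c ∈ DC, lin (tab TFC 72) 180 0 c = 0 → ktop (bitsOf 360 0 (doubleK GC 5 c)) = true)
    (hmB : ∀ c ∈ DB, lin (tab TFB 42) 90 0 c = 0 → nodeC (bitsOf 180 0 (doubleK GB 5 c)) = true)
    (hmA : ∀ c ∈ DA, lin (tab TFA 24) 45 0 c = 0 → nodeB (bitsOf 90 0 (doubleK GA 5 c)) = true)
    (hzC : ∀ b, b < 5 → ∀ k, k < 4 →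
      zl k (tab TFC 72) (matchedB 6 6 5 DC) (tab TFC 72 (b * 36)) (2 ^ (b * 36)) (b * 36 + 1) 180 = true)
    (hzB : ∀ b, b < 5 → ∀ k, k < 4 →
      zl k (tab TFB 42) (matchedB 6 3 5 DB) (tab TFB 42 (b * 18)) (2 ^ (b * 18)) (b * 18 + 1) 90 = true)
    (hzA : ∀ b, b < 5 → ∀ k, k < 4 →
      zl k (tab TFA 24) (matchedB 3 3 5 DA) (tab TFA 24 (b * 9)) (2 ^ (b * 9)) (b * 9 + 1) 45 = true) : K2_BB144_X :=
  k2_bb144_X_of_data hU hW hBcheck hBincr hBsum (zeroA_of_zmemX (hW3_of_winsX hW) hmC hmB hmA hzC hzB hzA)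

end Summit.Ventures.QEC.CircuitDistance.ETower.SecX
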